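import Mathlib
import Summits.AtomisticToContinuum.HydrodynamicLimit.Theses.JParityClosure
import HarnessLib

/-!
# JParityClosure / ParityInBand — helper: from time-averaged to fixed-time convergence in
# probability

The engine of step (iv) of
`Summit.AtomisticToContinuum.HydrodynamicLimit.Theses.JParityClosure.ParityInBand`
(`brezinaFeireisl2018_thm_3_3`) identifies the limit Young measure for a.e. `(t,x)`; translated back
to the particle system this is convergence of the tested empirical fields IN MEASURE IN TIME
(`∫ P_N(|X_N(s) - G(s)| > δ) ds → 0`), whereas the packing-guarded conjunct `HydroLimitInBand`
(the conclusion of `ParityInBand`, and `TendstoHydroFieldsAt … t`) asks for convergence in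
probability at EVERY FIXED instant `t`. This file proves the abstract upgrade: time-averaged
convergence near `t` + equicontinuity in probability of `s ↦ X_N(s)` at `t` (uniformly in large
`N`) + continuity of the limit `G` at `t` ⇒ convergence in probability at `t`. For the density and
momentum fields the equicontinuity follows from the bounded (at most quadratic) fluxes; for the
energy field it is exactly what needs the cubic tail input (`EnergyCurrentTails`) and a bound on the
collisional energy transfer (see the item's evidence note) — this lemma is the place where those
inputs are consumed.
-/

namespace Summit.AtomisticToContinuum.HydrodynamicLimit.Theorems

open Set MeasureTheory Filter Topology
open scoped ENNReal

/-- **Fixed-time convergence from time-averaged convergence and equicontinuity.** Let `P N` be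
measures, `X N : ℝ → Ω N → ℝ` processes and `G : ℝ → ℝ` continuous at `t`. If for every `δ > 0`
the time-integrated deviation probabilities `∫⁻ s ∈ (t, t+Δ₀), P N {δ < |X N s - G s|}` tend to `0`
(convergence in measure in time, to the right of `t`), and `s ↦ X N s` is equicontinuous in
probability at `t` from the right, uniformly in large `N` (for all `δ, η > 0` some window
`(t, t+Δ)` on which `P N {δ < |X N s - X N t|} ≤ η` for all large `N`), then
`P N {δ < |X N t - G t|} → 0` for every `δ > 0`. (Union bound at each `s` of the window, then
average over the window.) [folklore] -/
theorem tendsto_measure_fixedTime_of_timeAverage {Ω : ℕ → Type*} [∀ N, MeasurableSpace (Ω N)]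
    (P : ∀ N, Measure (Ω N)) (X : ∀ N, ℝ → Ω N → ℝ) (G : ℝ → ℝ) {t Δ₀ : ℝ}
    (hG : ContinuousAt G t)
    (havg : ∀ δ : ℝ, 0 < δ → Tendsto (fun N => ∫⁻ s in Ioo t (t + Δ₀),
      P N {ω | δ < |X N s ω - G s|}) atTop (𝓝 0))
    (hequi : ∀ δ : ℝ, 0 < δ → ∀ η : ℝ, 0 < η → ∃ Δ : ℝ, 0 < Δ ∧ Δ ≤ Δ₀ ∧ ∃ N₀ : ℕ, ∀ N, N₀ ≤ N →
      ∀ s ∈ Ioo t (t + Δ), P N {ω | δ < |X N s ω - X N t ω|} ≤ ENNReal.ofReal η) :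
    ∀ δ : ℝ, 0 < δ → Tendsto (fun N => P N {ω | δ < |X N t ω - G t|}) atTop (𝓝 0) := by
  intro δ hδ
  rw [ENNReal.tendsto_nhds_zero]
  intro ε hε
  -- work with a finite positive real `η ≤ ε / 2`
  obtain ⟨η, hη, hηε⟩ : ∃ η : ℝ, 0 < η ∧ 2 * ENNReal.ofReal η ≤ ε := by
    rcases eq_or_ne ε ⊤ with h | h
    · exact ⟨1, one_pos, by simp [h]⟩
    · refine ⟨ε.toReal / 2, by
        have : 0 < ε.toReal := ENNReal.toReal_pos hε.ne' h
        linarith, ?_⟩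
      rw [← ENNReal.ofReal_ofNat 2, ← ENNReal.ofReal_mul (by norm_num)]
      have : (2 : ℝ) * (ε.toReal / 2) = ε.toReal := by ring
      rw [this, ENNReal.ofReal_toReal h]
  set δ' : ℝ := δ / 3 with hδ'
  have hδ'pos : 0 < δ' := by positivity
  -- continuity of `G` at `t`
  obtain ⟨Δ₁, hΔ₁, hGΔ⟩ : ∃ Δ₁ > 0, ∀ s, |s - t| < Δ₁ → |G s - G t| < δ' := by
    have := Metric.continuousAt_iff.1 hG δ' hδ'pos
    obtain ⟨Δ₁, hΔ₁, h⟩ := this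
    exact ⟨Δ₁, hΔ₁, fun s hs => by simpa [Real.dist_eq] using h (by simpa [Real.dist_eq] using hs)⟩
  -- equicontinuity window
  obtain ⟨Δ, hΔ, hΔΔ₀, N₀, hN₀⟩ := hequi δ' hδ'pos η hη
  set Δ₂ : ℝ := min Δ Δ₁ with hΔ₂
  have hΔ₂pos : 0 < Δ₂ := lt_min hΔ hΔ₁
  have hΔ₂Δ : Δ₂ ≤ Δ := min_le_left _ _
  have hΔ₂Δ₁ : Δ₂ ≤ Δ₁ := min_le_right _ _
  -- the union bound at each instant of the window
  have hpt : ∀ N, N₀ ≤ N → ∀ s ∈ Ioo t (t + Δ₂),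
      P N {ω | δ < |X N t ω - G t|} ≤
        P N {ω | δ' < |X N s ω - G s|} + ENNReal.ofReal η := by
    intro N hN s hs
    have hsΔ : s ∈ Ioo t (t + Δ) := ⟨hs.1, lt_of_lt_of_le hs.2 (by linarith)⟩
    have hGs : |G s - G t| < δ' := hGΔ s (by
      rw [abs_lt]; constructor <;> linarith [hs.1, hs.2])
    have hsub : {ω | δ < |X N t ω - G t|} ⊆
        {ω | δ' < |X N s ω - G s|} ∪ {ω | δ' < |X N s ω - X N t ω|} := by
      intro ω hω
      simp only [mem_setOf_eq, mem_union] at hω ⊢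
      by_contra hcon
      rw [not_or, not_lt, not_lt] at hcon
      have h1 : |X N t ω - G t| ≤ |X N s ω - X N t ω| + |X N s ω - G s| + |G s - G t| := by
        have e : X N t ω - G t = -(X N s ω - X N t ω) + (X N s ω - G s) + (G s - G t) := by ring
        rw [e]
        refine (abs_add_le _ _).trans (add_le_add ((abs_add_le _ _).trans (add_le_add ?_ le_rfl)) le_rfl)
        rw [abs_neg]
      linarith [hcon.1, hcon.2]
    calc P N {ω | δ < |X N t ω - G t|}
        ≤ P N ({ω | δ' < |X N s ω - G s|} ∪ {ω | δ' < |X N s ω - X N t ω|}) := measure_mono hsub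
      _ ≤ P N {ω | δ' < |X N s ω - G s|} + P N {ω | δ' < |X N s ω - X N t ω|} :=
          measure_union_le _ _
      _ ≤ P N {ω | δ' < |X N s ω - G s|} + ENNReal.ofReal η := by
          gcongr
          exact hN₀ N hN s hsΔ
  -- average over the window
  have hwin : (volume (Ioo t (t + Δ₂))) = ENNReal.ofReal Δ₂ := by
    rw [Real.volume_Ioo]; congr 1; ring
  have havg' : Tendsto (fun N => ∫⁻ s in Ioo t (t + Δ₂), P N {ω | δ' < |X N s ω - G s|}) atTop (𝓝 0) := by
    refine tendsto_of_tendsto_of_tendsto_of_le_of_le tendsto_const_nhds (havg δ' hδ'pos)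
      (fun N => zero_le) fun N => ?_
    exact lintegral_mono_set (Ioo_subset_Ioo le_rfl (by linarith))
  have hΔ₂E : ENNReal.ofReal Δ₂ ≠ 0 := by
    rw [ENNReal.ofReal_ne_zero_iff]; exact hΔ₂pos
  have hΔ₂E' : ENNReal.ofReal Δ₂ ≠ ⊤ := ENNReal.ofReal_ne_top
  -- eventually the averaged term is at most `η Δ₂`
  have hev : ∀ᶠ N in atTop, ∫⁻ s in Ioo t (t + Δ₂), P N {ω | δ' < |X N s ω - G s|} ≤
      ENNReal.ofReal η * ENNReal.ofReal Δ₂ := by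
    have hpos : 0 < ENNReal.ofReal η * ENNReal.ofReal Δ₂ :=
      ENNReal.mul_pos (by rw [ENNReal.ofReal_ne_zero_iff]; exact hη) hΔ₂E
    exact (ENNReal.tendsto_nhds_zero.1 havg') _ hpos
  filter_upwards [hev, eventually_ge_atTop N₀] with N hN1 hN2
  -- integrate the pointwise bound over the window
  have hint : P N {ω | δ < |X N t ω - G t|} * ENNReal.ofReal Δ₂ ≤
      (∫⁻ s in Ioo t (t + Δ₂), P N {ω | δ' < |X N s ω - G s|}) +
        ENNReal.ofReal η * ENNReal.ofReal Δ₂ := by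
    have h1 : P N {ω | δ < |X N t ω - G t|} * ENNReal.ofReal Δ₂ =
        ∫⁻ _ in Ioo t (t + Δ₂), P N {ω | δ < |X N t ω - G t|} := by
      rw [setLIntegral_const, hwin]
    have h2 : ENNReal.ofReal η * ENNReal.ofReal Δ₂ =
        ∫⁻ _ in Ioo t (t + Δ₂), ENNReal.ofReal η := by
      rw [setLIntegral_const, hwin]
    rw [h1, h2, ← lintegral_add_right _ measurable_const]
    refine setLIntegral_mono_ae' measurableSet_Ioo (ae_of_all _ fun s hs => ?_)
    exact hpt N hN2 s hs
  -- divide by `Δ₂`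
  have hfin : P N {ω | δ < |X N t ω - G t|} ≤ ENNReal.ofReal η + ENNReal.ofReal η := by
    have h3 : P N {ω | δ < |X N t ω - G t|} * ENNReal.ofReal Δ₂ ≤
        (ENNReal.ofReal η + ENNReal.ofReal η) * ENNReal.ofReal Δ₂ :=
      calc _ ≤ _ := hint
        _ ≤ ENNReal.ofReal η * ENNReal.ofReal Δ₂ + ENNReal.ofReal η * ENNReal.ofReal Δ₂ :=
            add_le_add hN1 le_rfl
        _ = (ENNReal.ofReal η + ENNReal.ofReal η) * ENNReal.ofReal Δ₂ := by rw [add_mul]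
    exact (ENNReal.mul_le_mul_iff_left hΔ₂E hΔ₂E').1 h3
  exact hfin.trans (by rwa [← two_mul])

end Summit.AtomisticToContinuum.HydrodynamicLimit.Theorems
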